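import Summits.BirchSwinnertonDyer.BirchSwinnertonDyer.Theorems.ManinLocalTwoThreeVertexExtensionOddPrelim
import HarnessLib

/-!
# E-es-41m for ODD `t` modulo the characteristic-`2` extension criterion for `SL₂(𝔽_t)`-quotients (F-es-27′)

Summit `BirchSwinnertonDyer`, route `ManinLocalTwoThree` (cell bsd-f2-manin), crux C2 `ManinOddAtFour` (stmt-BirchSwinnertonDyer-22967),
line `kato_shift_two` v6, stub 3 `stub_cThreeImageResidual`; MEMO-es §25.10 (V-a) («UNIQUE EXTENSION ũ₀ … for t odd it vanishes
outright by F-es-27») and §25.12 (6) «VERTEX E-es-41m := … [t odd] EXT-CRIT (F-es-27 FACT)».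

**`shiftInvariantIsOldUpToDiamond_odd_of_extensionFact`**: for an odd prime `t ∤ L′` and a field `K` of characteristic `2`,
every `t`-shift-invariant homomorphism `u₁` on `Γ₀(L′t)` is `π₁^* u₀ + ψ∘(d mod t)` for a homomorphism `u₀` on `Γ₀(L′)` — the
conclusion of es's E-es-41m `ShiftInvariantIsOldUpToDiamondMin 2 t` (HOME/es/Sketch-es-g12.lean) — PROVIDED the extension
criterion F-es-27′ holds at `t`: «for `π : G ↠ SL₂(ℤ/t)` and a `G`-invariant additive `φ` on `ker π` with values in a field of
characteristic `2`, `φ` extends to an additive `Φ` on `G`» (Hochschild–Serre + `H²(SL₂(𝔽_t); 𝔽₂) = 0` for odd `t`; a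
Literature FACT for -ty, taken here as a hypothesis in body form).  Route (prelude `…VertexExtensionOddPrelim.lean`):
`π : Γ₀(L′) ↠ SL₂(ℤ/t)` (`exists_Gamma0_reduce_eq`), `N = ker π ⊆ B = Γ₀(L′t)`, `φ = u₁|_N` is `Γ₀(L′)`-invariant
(`conj_invariant_of_shiftInvariant`), so F-es-27′ gives `Φ`; then `χ := Φ|_B − u₁` is additive on `B`, kills `N`, kills `T`
(`t·χ(T) = χ(T^t) = 0`, `t` odd, characteristic `2`) hence kills `B₁ = {a ≡ d ≡ 1 (t)}` (`m = n·T^{b}`), so `χ(β)` depends only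
on `d_β mod t`: `χ = ψ∘d`.

No new definitions; nothing about BSD or Manin's conjecture is proved here.

References: G. Shimura (1971) §8.3 [cite: Shimura1971, §8.3 (8.3.2)]; Z. Fiedorowicz, S. Priddy, *Homology of classical groups over
finite fields and their associated infinite loop spaces*, LNM 674 (1978), Thm IV.6.1; cell memo HOME/MEMO-es.md §25.10–§25.12.
-/

set_option autoImplicit false
set_option linter.dupNamespace false

open scoped MatrixGroups

open CongruenceSubgroup Literature.NumberTheory.EllipticCurves.ModularForms
  Literature.NumberTheory.EllipticCurves.ModularForms.HidaCohomology
  Summit.BirchSwinnertonDyer.Rank1Residual.ManinAdditive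

namespace Summit.BirchSwinnertonDyer.BirchSwinnertonDyer.Theorems.ManinLocalTwoThree

noncomputable section

section OddVertex

variable {t L' : ℕ} {K : Type} [Field K] [NeZero L'] [NeZero t]

/-- Powers of an element under an additive function on `Γ₀(M)` (plumbing). [folklore] -/
theorem apply_pow_eq_nsmul {M : ℕ} (χ : Gamma0 M → K) (hχ : ∀ a b : Gamma0 M, χ (a * b) = χ a + χ b) (β : Gamma0 M) :
    ∀ m : ℕ, χ (β ^ m) = m • χ β := by
  have h1 : χ 1 = 0 := by have := hχ 1 1; rw [mul_one] at this; simpa using this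
  intro m
  induction m with
  | zero => rw [pow_zero, zero_smul]; exact h1
  | succ m ih => rw [pow_succ, hχ, ih, succ_nsmul]

/-- In characteristic `2` an odd natural number is `1` (plumbing). [folklore] -/
theorem natCast_eq_one_of_odd [CharP K 2] {m : ℕ} (hm : Odd m) : (m : K) = 1 := by
  obtain ⟨k, rfl⟩ := hm
  have h2 : ((2 : ℕ) : K) = 0 := CharP.cast_eq_zero K 2
  push_cast at h2 ⊢
  rw [h2, zero_mul, zero_add]

/-- The translation `T = (1 1; 0 1)` as an element of `Γ₀(M)` and the reduction of `T^m` (plumbing). [folklore] -/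
theorem T_zpow_mem_Gamma0' (M : ℕ) (m : ℤ) : ModularGroup.T ^ m ∈ Gamma0 M := by
  rw [Gamma0_mem, ModularGroup.coe_T_zpow]; simp

/-- **E-es-41m for ODD `t`, modulo F-es-27′.**  Let `t` be an odd prime not dividing `L′`, `K` a field of characteristic
`2`, and assume the characteristic-`2` extension criterion for `SL₂(ℤ/t)`-quotients (F-es-27′, hypothesis `hF`, body form).
Then every `t`-shift-invariant degree-`0` cocycle `u₁` on `Γ₀(L′t)` decomposes as `u₁ = π₁^* u₀ + ψ∘(d mod t)` with `u₀` a
degree-`0` cocycle on `Γ₀(L′)` and `ψ : ℤ/t → K` — the conclusion of `EsG12.ShiftInvariantIsOldUpToDiamondMin 2 t`.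
[cite: Shimura1971, §8.3 (8.3.2)] -/
theorem shiftInvariantIsOldUpToDiamond_odd_of_extensionFact [CharP K 2] (htp : t.Prime) (ht2 : t ≠ 2)
    (hF : ∀ (G : Type) [Group G] (K : Type) [Field K] [CharP K 2] (π : G →* SL(2, ZMod t)),
      Function.Surjective π → ∀ φ : G → K,
      (∀ n ∈ π.ker, ∀ n' ∈ π.ker, φ (n * n') = φ n + φ n') →
      (∀ g : G, ∀ n ∈ π.ker, φ (g * n * g⁻¹) = φ n) →
      ∃ Φ : G → K, (∀ g g' : G, Φ (g * g') = Φ g + Φ g') ∧ ∀ n ∈ π.ker, Φ n = φ n)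
    (hL' : ¬ t ∣ L') (u : cocycles 0 (L' * t) K)
    (hshift : degeneracyPullback 0 (L' * t) (L' * t * t) t K dvd_rfl (u : Gamma0 (L' * t) → Fin 1 → K) =
      degeneracyPullback 0 (L' * t) (L' * t * t) 1 K (by simp) (u : Gamma0 (L' * t) → Fin 1 → K)) :
    ∃ (u₀ : cocycles 0 L' K) (ψ : ZMod t → K),
      (u : Gamma0 (L' * t) → Fin 1 → K) =
        degeneracyPullback 0 L' (L' * t) 1 K (by simp) (u₀ : Gamma0 L' → Fin 1 → K) + diamondFun (L' * t) t K ψ := by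
  classical
  have hcop : Nat.Coprime t L' := (Nat.Prime.coprime_iff_not_dvd htp).2 hL'
  haveI : Fact t.Prime := ⟨htp⟩
  set uf : Gamma0 (L' * t) → Fin 1 → K := (u : Gamma0 (L' * t) → Fin 1 → K) with huf
  have hu : uf ∈ cocycles 0 (L' * t) K := u.2
  -- the reduction map on `Γ₀(L′)` and its kernel
  let π : Gamma0 L' →* SL(2, ZMod t) :=
    (Matrix.SpecialLinearGroup.map (Int.castRingHom (ZMod t))).comp (Gamma0 L').subtype
  have hπ : ∀ g : Gamma0 L', π g = Matrix.SpecialLinearGroup.map (Int.castRingHom (ZMod t)) (g : SL(2, ℤ)) := fun _ => rfl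
  have hπsurj : Function.Surjective π := by
    intro A
    obtain ⟨γ, hγ, hγA⟩ := exists_Gamma0_reduce_eq hcop A
    exact ⟨⟨γ, hγ⟩, hγA⟩
  have hker : ∀ g : Gamma0 L', g ∈ π.ker ↔ Matrix.SpecialLinearGroup.map (Int.castRingHom (ZMod t)) (g : SL(2, ℤ)) = 1 :=
    fun g => by rw [MonoidHom.mem_ker, hπ]
  have hkerB : ∀ g : Gamma0 L', g ∈ π.ker → ((L' * t : ℕ) : ℤ) ∣ (g : SL(2, ℤ)) 1 0 :=
    fun g hg => dvd_level_of_reduce_eq_one hcop g ((reduce_eq_one_iff _).1 ((hker g).1 hg)).2.2.1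
  -- `φ := u₁` on `B`, `0` elsewhere
  let φ : Gamma0 L' → K := fun g =>
    if h : ((L' * t : ℕ) : ℤ) ∣ (g : SL(2, ℤ)) 1 0 then uf ⟨(g : SL(2, ℤ)), mem_Gamma0_mul_of_dvd _ h⟩ 0 else 0
  have hφ : ∀ (g : Gamma0 L') (h : ((L' * t : ℕ) : ℤ) ∣ (g : SL(2, ℤ)) 1 0),
      φ g = uf ⟨(g : SL(2, ℤ)), mem_Gamma0_mul_of_dvd _ h⟩ 0 := fun g h => dif_pos h
  have hφmul : ∀ n ∈ π.ker, ∀ n' ∈ π.ker, φ (n * n') = φ n + φ n' := by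
    intro n hn n' hn'
    have hnn' : n * n' ∈ π.ker := mul_mem hn hn'
    rw [hφ _ (hkerB _ hnn'), hφ _ (hkerB _ hn), hφ _ (hkerB _ hn')]
    have e : (⟨((n * n' : Gamma0 L') : SL(2, ℤ)), mem_Gamma0_mul_of_dvd _ (hkerB _ hnn')⟩ : Gamma0 (L' * t)) =
        ⟨(n : SL(2, ℤ)), mem_Gamma0_mul_of_dvd _ (hkerB _ hn)⟩ * ⟨(n' : SL(2, ℤ)), mem_Gamma0_mul_of_dvd _ (hkerB _ hn')⟩ :=
      Subtype.ext rfl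
    rw [e, cocycle_zero_mul hu, Pi.add_apply]
  have hφinv : ∀ g : Gamma0 L', ∀ n ∈ π.ker, φ (g * n * g⁻¹) = φ n := by
    intro g n hn
    have hn1 := (hker n).1 hn
    have hgn := dvd_level_conj_of_reduce_eq_one hcop g n hn1
    rw [hφ _ hgn.2, hφ _ (hkerB _ hn)]
    exact congrFun (conj_invariant_of_shiftInvariant hu hshift htp hcop g n hn1) 0
  -- F-es-27′
  obtain ⟨Φ, hΦadd, hΦN⟩ := hF (Gamma0 L') K π hπsurj φ hφmul hφinv
  have hΦone : Φ 1 = 0 := by have := hΦadd 1 1; rw [mul_one] at this; simpa using this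
  -- `u₀ := Φ`
  let u₀f : Gamma0 L' → Fin 1 → K := fun g _ => Φ g
  have hu₀ : u₀f ∈ cocycles 0 L' K := by
    rw [mem_cocycles_iff]
    intro γ δ
    funext i
    simp only [u₀f, Pi.add_apply, act_zero_eq_id, LinearMap.id_apply]
    rw [hΦadd, add_comm]
  -- `χ := Φ|_B − u₁`
  let ι1 : Gamma0 (L' * t) →* Gamma0 L' := Gamma0.degeneracyConj L' (L' * t) 1 (by simp)
  have hι1 : ∀ β : Gamma0 (L' * t), ((ι1 β : Gamma0 L') : SL(2, ℤ)) = (β : SL(2, ℤ)) :=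
    fun β => Gamma0.coe_degeneracyConj_one _ β
  let χ : Gamma0 (L' * t) → K := fun β => Φ (ι1 β) - uf β 0
  have hχadd : ∀ a b : Gamma0 (L' * t), χ (a * b) = χ a + χ b := by
    intro a b
    simp only [χ, map_mul, hΦadd, cocycle_zero_mul hu, Pi.add_apply]
    ring
  -- `χ` kills the elements `≡ 1 (mod t)`
  have hχN : ∀ β : Gamma0 (L' * t), Matrix.SpecialLinearGroup.map (Int.castRingHom (ZMod t)) (β : SL(2, ℤ)) = 1 → χ β = 0 := by
    intro β hβ
    have hmem : ι1 β ∈ π.ker := by rw [hker, hι1]; exact hβ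
    have h1 : Φ (ι1 β) = φ (ι1 β) := hΦN _ hmem
    have h2 : φ (ι1 β) = uf β 0 := by
      rw [hφ _ (hkerB _ hmem)]
      have e : (⟨((ι1 β : Gamma0 L') : SL(2, ℤ)), mem_Gamma0_mul_of_dvd _ (hkerB _ hmem)⟩ : Gamma0 (L' * t)) = β :=
        Subtype.ext (hι1 β)
      rw [e]
    simp only [χ, h1, h2, sub_self]
  -- `χ(T) = 0`: `T^t ≡ 1 (mod t)` and `t` is odd, `char K = 2`
  let TB : Gamma0 (L' * t) := ⟨ModularGroup.T ^ (1 : ℤ), T_zpow_mem_Gamma0' _ 1⟩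
  have hTB1 : ((TB : Gamma0 (L' * t)) : SL(2, ℤ)) = ModularGroup.T := zpow_one _
  have hTBpow : ∀ m : ℕ, ((TB ^ m : Gamma0 (L' * t)) : SL(2, ℤ)) = ModularGroup.T ^ (m : ℤ) := by
    intro m
    push_cast
    rw [hTB1, zpow_natCast]
  have hχT : χ TB = 0 := by
    have hTt : Matrix.SpecialLinearGroup.map (Int.castRingHom (ZMod t)) ((TB ^ t : Gamma0 (L' * t)) : SL(2, ℤ)) = 1 := by
      rw [hTBpow, reduce_eq_one_iff]
      have e : ((ModularGroup.T ^ (t : ℤ) : SL(2, ℤ)) : Matrix (Fin 2) (Fin 2) ℤ) = !![1, (t : ℤ); 0, 1] :=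
        ModularGroup.coe_T_zpow _
      refine ⟨?_, ?_, ?_, ?_⟩
      · show ((((ModularGroup.T ^ (t : ℤ) : SL(2, ℤ)) : Matrix (Fin 2) (Fin 2) ℤ) 0 0 : ℤ) : ZMod t) = 1; rw [e]; simp
      · show ((((ModularGroup.T ^ (t : ℤ) : SL(2, ℤ)) : Matrix (Fin 2) (Fin 2) ℤ) 0 1 : ℤ) : ZMod t) = 0; rw [e]; simp
      · show ((((ModularGroup.T ^ (t : ℤ) : SL(2, ℤ)) : Matrix (Fin 2) (Fin 2) ℤ) 1 0 : ℤ) : ZMod t) = 0; rw [e]; simp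
      · show ((((ModularGroup.T ^ (t : ℤ) : SL(2, ℤ)) : Matrix (Fin 2) (Fin 2) ℤ) 1 1 : ℤ) : ZMod t) = 1; rw [e]; simp
    have h := hχN _ hTt
    rw [apply_pow_eq_nsmul χ hχadd TB t, nsmul_eq_mul, natCast_eq_one_of_odd (htp.odd_of_ne_two ht2), one_mul] at h
    exact h
  -- `χ` kills `B₁ = {a ≡ d ≡ 1 (mod t)}`
  have hχB1 : ∀ m : Gamma0 (L' * t), ((((m : SL(2, ℤ)) 0 0 : ℤ)) : ZMod t) = 1 → ((((m : SL(2, ℤ)) 1 1 : ℤ)) : ZMod t) = 1 →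
      χ m = 0 := by
    intro m ha hd
    have htL : (t : ℤ) ∣ ((L' * t : ℕ) : ℤ) := ⟨(L' : ℤ), by push_cast; ring⟩
    have hc : ((((m : SL(2, ℤ)) 1 0 : ℤ)) : ZMod t) = 0 :=
      (ZMod.intCast_zmod_eq_zero_iff_dvd _ _).2 (htL.trans (ManinFrameResidueProperRTameTwist.natCast_dvd_entry10 m))
    -- `b' := b mod t` as a natural number, `n := m · T^{-b'}`
    let b' : ℕ := ((((m : SL(2, ℤ)) 0 1 : ℤ) : ZMod t)).val
    have hb' : ((b' : ℕ) : ZMod t) = (((m : SL(2, ℤ)) 0 1 : ℤ) : ZMod t) := ZMod.natCast_zmod_val _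
    let n : Gamma0 (L' * t) := m * (TB ^ b')⁻¹
    have hmn : m = n * TB ^ b' := by simp [n]
    have hncoe : ((n : SL(2, ℤ)) : Matrix (Fin 2) (Fin 2) ℤ) =
        ((m : SL(2, ℤ)) : Matrix (Fin 2) (Fin 2) ℤ) * !![1, -(b' : ℤ); 0, 1] := by
      have e1 : ((n : SL(2, ℤ))) = (m : SL(2, ℤ)) * (ModularGroup.T ^ (b' : ℤ))⁻¹ := by
        show (((m * (TB ^ b')⁻¹ : Gamma0 (L' * t)) : SL(2, ℤ))) = _
        push_cast
        rw [hTB1, zpow_natCast]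
      rw [e1, ← zpow_neg, Matrix.SpecialLinearGroup.coe_mul, ModularGroup.coe_T_zpow]
    have hn1 : Matrix.SpecialLinearGroup.map (Int.castRingHom (ZMod t)) (n : SL(2, ℤ)) = 1 := by
      rw [reduce_eq_one_iff]
      have e00 : ((n : SL(2, ℤ)) 0 0 : ℤ) = (m : SL(2, ℤ)) 0 0 := by
        show ((n : SL(2, ℤ)) : Matrix (Fin 2) (Fin 2) ℤ) 0 0 = _
        rw [hncoe]; simp [Matrix.mul_apply, Fin.sum_univ_two]
      have e01 : ((n : SL(2, ℤ)) 0 1 : ℤ) = -((m : SL(2, ℤ)) 0 0) * b' + (m : SL(2, ℤ)) 0 1 := by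
        show ((n : SL(2, ℤ)) : Matrix (Fin 2) (Fin 2) ℤ) 0 1 = _
        rw [hncoe]; simp [Matrix.mul_apply, Fin.sum_univ_two]
      have e10 : ((n : SL(2, ℤ)) 1 0 : ℤ) = (m : SL(2, ℤ)) 1 0 := by
        show ((n : SL(2, ℤ)) : Matrix (Fin 2) (Fin 2) ℤ) 1 0 = _
        rw [hncoe]; simp [Matrix.mul_apply, Fin.sum_univ_two]
      have e11 : ((n : SL(2, ℤ)) 1 1 : ℤ) = -((m : SL(2, ℤ)) 1 0) * b' + (m : SL(2, ℤ)) 1 1 := by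
        show ((n : SL(2, ℤ)) : Matrix (Fin 2) (Fin 2) ℤ) 1 1 = _
        rw [hncoe]; simp [Matrix.mul_apply, Fin.sum_univ_two]
      refine ⟨by rw [e00]; exact ha, ?_, by rw [e10]; exact hc, ?_⟩
      · rw [e01]; push_cast; rw [ha, hb']; ring
      · rw [e11]; push_cast; rw [hc, hd]; ring
    rw [hmn, hχadd, hχN n hn1, apply_pow_eq_nsmul χ hχadd TB b', hχT, smul_zero, add_zero]
  -- `χ β` depends only on `d_β mod t`
  have hχd : ∀ β β' : Gamma0 (L' * t), ((((β : SL(2, ℤ)) 1 1 : ℤ)) : ZMod t) = (((β' : SL(2, ℤ)) 1 1 : ℤ) : ZMod t) →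
      χ β = χ β' := by
    intro β β' hββ'
    have htL : t ∣ L' * t := Dvd.intro_left _ rfl
    have haβ := gamma0_a_mul_d_cast htL β
    have haβ' := gamma0_a_mul_d_cast htL β'
    have hcβ := gamma0_c_cast_eq_zero htL β
    have hcβ' := gamma0_c_cast_eq_zero htL β'
    let m : Gamma0 (L' * t) := β' * β⁻¹
    have hm00 : ((((m : SL(2, ℤ)) 0 0 : ℤ)) : ZMod t) = 1 := by
      have e : ((m : SL(2, ℤ)) 0 0 : ℤ) = (β' : SL(2, ℤ)) 0 0 * (β : SL(2, ℤ)) 1 1 - (β' : SL(2, ℤ)) 0 1 * (β : SL(2, ℤ)) 1 0 := by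
        show (((β' : SL(2, ℤ)) * (β : SL(2, ℤ))⁻¹ : SL(2, ℤ)) : Matrix (Fin 2) (Fin 2) ℤ) 0 0 = _
        rw [Matrix.SpecialLinearGroup.coe_mul, Matrix.mul_apply, Fin.sum_univ_two]
        show (β' : SL(2, ℤ)) 0 0 * ((β : SL(2, ℤ))⁻¹) 0 0 + (β' : SL(2, ℤ)) 0 1 * ((β : SL(2, ℤ))⁻¹) 1 0 = _
        rw [inv_apply_zero_zero, inv_apply_one_zero]; ring
      rw [e]; push_cast; rw [hcβ, mul_zero, sub_zero, hββ']; exact haβ'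
    have hm11 : ((((m : SL(2, ℤ)) 1 1 : ℤ)) : ZMod t) = 1 := by
      have e : ((m : SL(2, ℤ)) 1 1 : ℤ) = -((β' : SL(2, ℤ)) 1 0 * (β : SL(2, ℤ)) 0 1) + (β' : SL(2, ℤ)) 1 1 * (β : SL(2, ℤ)) 0 0 := by
        show (((β' : SL(2, ℤ)) * (β : SL(2, ℤ))⁻¹ : SL(2, ℤ)) : Matrix (Fin 2) (Fin 2) ℤ) 1 1 = _
        rw [Matrix.SpecialLinearGroup.coe_mul, Matrix.mul_apply, Fin.sum_univ_two]
        show (β' : SL(2, ℤ)) 1 0 * ((β : SL(2, ℤ))⁻¹) 0 1 + (β' : SL(2, ℤ)) 1 1 * ((β : SL(2, ℤ))⁻¹) 1 1 = _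
        rw [inv_apply_zero_one, inv_apply_one_one]; ring
      rw [e]; push_cast; rw [hcβ', zero_mul, neg_zero, zero_add, ← hββ', mul_comm]; exact haβ
    have e : β' = m * β := by simp [m]
    rw [e, hχadd, hχB1 m hm00 hm11, zero_add]
  -- `ψ`
  let ψ : ZMod t → K := fun x =>
    if h : ∃ β : Gamma0 (L' * t), ((((β : SL(2, ℤ)) 1 1 : ℤ)) : ZMod t) = x then χ (Classical.choose h) else 0
  have hψ : ∀ β : Gamma0 (L' * t), ψ ((((β : SL(2, ℤ)) 1 1 : ℤ)) : ZMod t) = χ β := by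
    intro β
    have hex : ∃ β₀ : Gamma0 (L' * t), ((((β₀ : SL(2, ℤ)) 1 1 : ℤ)) : ZMod t) = (((β : SL(2, ℤ)) 1 1 : ℤ) : ZMod t) := ⟨β, rfl⟩
    show (if h : _ then χ (Classical.choose h) else 0) = χ β
    rw [dif_pos hex]
    exact hχd _ _ (Classical.choose_spec hex)
  refine ⟨⟨u₀f, hu₀⟩, fun x => -ψ x, ?_⟩
  funext β i
  obtain rfl : i = 0 := Fin.eq_zero i
  rw [Pi.add_apply, Pi.add_apply, degeneracyPullback_zero_apply, diamondFun_apply, hψ β]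
  show uf β 0 = Φ (ι1 β) + -(Φ (ι1 β) - uf β 0)
  ring

end OddVertex

end

end Summit.BirchSwinnertonDyer.BirchSwinnertonDyer.Theorems.ManinLocalTwoThree
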